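import Summits.QuantumFields.BalabanUV.T4Continuum.Support.RegionGaugeBoxHole

/-!
# `BalabanUV.T4Continuum.Support.RegionGaugeScatteredBoxes` — NE2 (node U1a) formalisation swarm, SUPPLIER item «Δ1-VEC-W1-HOLED» v3 under
# the owner's sub-row `T4-U1a.S-NE2-D1-DIRICHLET°` (vector layer W1): **W1 WITH ONE LEVEL-UNIFORM CONSTANT ON THE COMPLEMENT OF ANY SCATTERED
# FAMILY OF BOXES OF BLOCKS** (finitely many boxes whose collars are pairwise disjoint) «not in print; our construction»
# (unit b2b-balaban-t4-ne2-formalise-leaf-09, gen 9, v1)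

HONEST FRAMING (T4-DAG p. 1).  [folklore] `U = 1`, the faithful single-scale star-bond operator, ONE region `S = T ∖ ⋃_t K_t`, `K_t =
Π_ν [lo^t_ν, lo^t_ν + len^t_ν)` (`1 ≤ len^t_ν`, `len^t_ν + 2 ≤ M_ν`), the collars PAIRWISE DISJOINT as block sets (`cblk^t k ≠ cblk^{t′} k′`
for `t ≠ t′`, all offsets).  The correction is the sum of the box lifts (`RegionGaugeBoxHole`); disjoint collars ⟹ `λ = μ̃` on every box and
`nsq (∂λ) ≤ Σ_t nsq (∂ lift_t)`; the boxes' internal bonds are distinct bonds, so their gradient sums add up inside `nsq (ext A − ∂μ̃)`.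
SAME constant `holedConst d a a′`.  This is the widest class of the v3 method: every exterior component a box, components well separated;
exterior components that are not boxes (L-shapes, …) and close components remain OPEN.  Nothing printed is a hypothesis; NE2 (U1a) NOT
proved; spine PROVED 0/9 unchanged; NOT [B9] (3.16)∕(3.23)–(3.27) as printed; NOT infinite volume, NOT the mass gap, NOT Clay.  HONEST
DEPENDENCY (verbatim): «continuum YM on T⁴ ⇐ BetaPertH ∧ nine spine estimates (0/9 proved); BetaPertH ⇐ (D1) ∧ (D4) ∧ CAP+tail; G-an2-4
gates asym, D1 and NE2/3/4.»

ABSOLUTE RULE (cell, verbatim): «No internally-minted statement may enter as a cited fact. Every hypothesis is either kernel-proved in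
this package or a verbatim quotation of a PUBLISHED theorem with page reference. The manuscript(s) under audit are NOT citable for
their own disputed steps — they are the thing under adjudication; programme-internal (2001/route/tribunal) claims are never citable.»
[folklore] throughout; data defs `boxesBlocks` (a `Finset`), `liftT` (the summed lift); no `def … : Prop` (the family is a `Finset` of
(corner, side lengths) pairs and the separation a plain `∀` hypothesis).  NOT CLAIMED: non-box components; close components; W3̃; NE2; NE3.
-/

noncomputable section

open scoped BigOperators ComplexConjugate Matrix Matrix.Norms.L2Operator
open Finset

namespace Summit.QuantumFields.BalabanUV.T4Continuum.RegionGaugeScatteredBoxes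

open Literature.MathematicalPhysics.QuantumFieldTheory.Balaban1983to89.B5Prop11Plancherel (Tor fine unitVec)
open Literature.MathematicalPhysics.QuantumFieldTheory.Balaban1983to89.B5Prop11Lower (nsq nsq_nonneg)
open Literature.MathematicalPhysics.QuantumFieldTheory.Balaban1983to89.B5Action121 (GradOp GradOp_mulVec sdiff sdiff_mulVec)
open Literature.MathematicalPhysics.QuantumFieldTheory.Balaban1983to89.B5Block118 (bpt QsOp)
open Literature.MathematicalPhysics.QuantumFieldTheory.Balaban1983to89.B5Blocks16 (blockOf blockOf_bpt)
open Literature.MathematicalPhysics.QuantumFieldTheory.Balaban1983to89.B5G183RateUnitTower (lev)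
open Summit.QuantumFields.BalabanUV.T4Continuum
open Summit.QuantumFields.BalabanUV.T4Continuum.SubtypeCompression (Coercive ext ext_apply_of ext_apply_of_not nsq_ext)
open Summit.QuantumFields.BalabanUV.T4Continuum.ScalarAveragedPropagator (gammaPs)
open Summit.QuantumFields.BalabanUV.T4Continuum.ScalarAveragedCompression (sigma0 sigma0_pos)
open Summit.QuantumFields.BalabanUV.T4Continuum.RegionScalarCompression (QOm GOm)
open Summit.QuantumFields.BalabanUV.T4Continuum.RegionGaugeFixedVector (starReg curlR gradR avgR regionDeltaA)
open Summit.QuantumFields.BalabanUV.T4Continuum.RegionGaugeSlice (SliceCoercive)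
open Summit.QuantumFields.BalabanUV.T4Continuum.RegionGaugeSliceOrth (OrthSliceCoercive)
open Summit.QuantumFields.BalabanUV.T4Continuum.RegionGaugeSliceOrthRegion (sliceCoercive_region_of_orthSlice
  coercive_regionDeltaA_of_orthSlice opNorm_inv_regionDeltaA_le_of_orthSlice)
open Summit.QuantumFields.BalabanUV.T4Continuum.RegionGaugeOrbit (orbitConst orbitConst_pos orthSlice_of_gaugePoincare)
open Summit.QuantumFields.BalabanUV.T4Continuum.RegionStarLineGaugeTower (orthSlice_one orbitConst_le)
open Summit.QuantumFields.BalabanUV.T4Continuum.DirichletRegionTower (gamD gamD_pos)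
open Summit.QuantumFields.BalabanUV.T4Continuum.RegionCollarFold (koff)
open Summit.QuantumFields.BalabanUV.T4Continuum.RegionBoxCollarFold
open Summit.QuantumFields.BalabanUV.T4Continuum.RegionBoxCollarCutoff
open Summit.QuantumFields.BalabanUV.T4Continuum.RegionBoxCollarLift
open Summit.QuantumFields.BalabanUV.T4Continuum.RegionGaugeHoled (exists_torus_gauge Kholed holedConst KC₂_nonneg)
open Summit.QuantumFields.BalabanUV.T4Continuum.RegionGaugeBoxHole
open Summit.QuantumFields.BalabanUV.Beta.GAN24.DirichletBoxCompression (toBlock_mulVec')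
open Summit.QuantumFields.BalabanUV.Beta.GAN24.DirichletBoxTrace (blockReg)

variable {d : ℕ} (n : ℕ) [NeZero n] (M : Fin d → ℕ) [hM : ∀ μ, NeZero (M μ)] (T : Finset (Tor M × (Fin d → ℕ))) (a a' : ℝ)

/-- **THE BLOCKS OF ALL THE BOXES** of the family, as one finite set. [folklore] -/
def boxesBlocks : Finset (Tor M) := T.biUnion fun t => boxBlocks M t.1 t.2


/-! ## §1 Disjoint collars -/

/-- a site lies in at most one collar of the family (disjointness, verbatim). [folklore] -/
theorem eq_of_mem_collarB
    (hsep : ∀ t ∈ T, ∀ t' ∈ T, t ≠ t' → ∀ k ∈ KOff t.2, ∀ k' ∈ KOff t'.2, cblkB M t.1 k ≠ cblkB M t'.1 k')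
    {t t' : Tor M × (Fin d → ℕ)} (ht : t ∈ T) (ht' : t' ∈ T) {x : Tor (fine n M)} (hx : x ∈ collarB n M t.1 t.2)
    (hx' : x ∈ collarB n M t'.1 t'.2) : t = t' := by
  by_contra hne
  exact hsep t ht t' ht' hne _ (koffB_mem_KOff n M t.1 t.2 hx) _ (koffB_mem_KOff n M t'.1 t'.2 hx')
    (by rw [← blockOf_eq_cblkB n M t.1 x, ← blockOf_eq_cblkB n M t'.1 x])

/-- a site of a box `K_{t′}` is not in the collar of another box `K_t`. [folklore] -/
theorem not_mem_collarB_of_mem_box (hT : ∀ t ∈ T, (∀ ν, 1 ≤ t.2 ν) ∧ ∀ ν, t.2 ν + 2 ≤ M ν)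
    (hsep : ∀ t ∈ T, ∀ t' ∈ T, t ≠ t' → ∀ k ∈ KOff t.2, ∀ k' ∈ KOff t'.2, cblkB M t.1 k ≠ cblkB M t'.1 k')
    {t t' : Tor M × (Fin d → ℕ)} (ht : t ∈ T) (ht' : t' ∈ T) (hne : t ≠ t') {x : Tor (fine n M)}
    (hx : blockOf n M x ∈ boxBlocks M t'.1 t'.2) : x ∉ collarB n M t.1 t.2 := by
  intro hxc
  have hin := (mem_boxBlocks_iff n M t'.1 t'.2 (hT t' ht').2 x).1 hx
  have hx' : x ∈ collarB n M t'.1 t'.2 := (mem_collarB n M t'.1 t'.2).2 fun ν => by have := (hin ν).2; omega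
  exact hne (eq_of_mem_collarB n M T hsep ht ht' hxc hx')

/-! ## §2 The summed lift -/

/-- **THE CORRECTION** `λ = Σ_{t ∈ T} lift_t μ̃`. [folklore] -/
def liftT (μt : Tor (fine n M) → ℂ) : Tor (fine n M) → ℂ := ∑ t ∈ T, liftB n M t.1 t.2 μt

/-- **`λ = μ̃` ON EVERY BOX**. [folklore] -/
theorem liftT_of_mem_box (hT : ∀ t ∈ T, (∀ ν, 1 ≤ t.2 ν) ∧ ∀ ν, t.2 ν + 2 ≤ M ν)
    (hsep : ∀ t ∈ T, ∀ t' ∈ T, t ≠ t' → ∀ k ∈ KOff t.2, ∀ k' ∈ KOff t'.2, cblkB M t.1 k ≠ cblkB M t'.1 k')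
    (μt : Tor (fine n M) → ℂ) {x : Tor (fine n M)} {t₀ : Tor M × (Fin d → ℕ)} (ht₀ : t₀ ∈ T)
    (hx : blockOf n M x ∈ boxBlocks M t₀.1 t₀.2) : liftT n M T μt x = μt x := by
  have hin := (mem_boxBlocks_iff n M t₀.1 t₀.2 (hT t₀ ht₀).2 x).1 hx
  rw [liftT, Finset.sum_apply, ← Finset.add_sum_erase T _ ht₀, liftB_of_inside n M t₀.1 t₀.2 μt hin]
  rw [Finset.sum_eq_zero, add_zero]
  intro t ht
  exact liftB_of_not_mem n M t.1 t.2 μt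
    (not_mem_collarB_of_mem_box n M T hT hsep (mem_of_mem_erase ht) ht₀ (ne_of_mem_erase ht) hx)

/-- **THE GRADIENT OF `λ` IS CARRIED BY ONE COLLAR AT A TIME**: `nsq (∂λ) ≤ Σ_t nsq (∂ lift_t μ̃)`. [folklore] -/
theorem nsq_grad_liftT_le (hT : ∀ t ∈ T, (∀ ν, 1 ≤ t.2 ν) ∧ ∀ ν, t.2 ν + 2 ≤ M ν)
    (hsep : ∀ t ∈ T, ∀ t' ∈ T, t ≠ t' → ∀ k ∈ KOff t.2, ∀ k' ∈ KOff t'.2, cblkB M t.1 k ≠ cblkB M t'.1 k')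
    (μt : Tor (fine n M) → ℂ) :
    nsq (GradOp (fine n M) (n : ℂ) *ᵥ liftT n M T μt) ≤ ∑ t ∈ T, nsq (GradOp (fine n M) (n : ℂ) *ᵥ liftB n M t.1 t.2 μt) := by
  classical
  have hlin : GradOp (fine n M) (n : ℂ) *ᵥ liftT n M T μt = ∑ t ∈ T, GradOp (fine n M) (n : ℂ) *ᵥ liftB n M t.1 t.2 μt := by
    rw [liftT, Matrix.mulVec_sum]
  unfold nsq
  rw [Finset.sum_comm]
  refine sum_le_sum fun b _ => ?_
  rw [hlin, Finset.sum_apply]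
  obtain ⟨x, ρ⟩ := b
  have hzero : ∀ t ∈ T, x ∉ collarB n M t.1 t.2 → (GradOp (fine n M) (n : ℂ) *ᵥ liftB n M t.1 t.2 μt) (x, ρ) = 0 := by
    intro t ht hx
    rw [GradOp_mulVec, sdiff_mulVec, liftB_step_of_not_mem n M t.1 t.2 (hT t ht).2 μt hx ρ, mul_zero]
  by_cases h : ∃ t₀ ∈ T, x ∈ collarB n M t₀.1 t₀.2
  · obtain ⟨t₀, ht₀, hx₀⟩ := h
    have hothers : ∀ t ∈ T.erase t₀, (GradOp (fine n M) (n : ℂ) *ᵥ liftB n M t.1 t.2 μt) (x, ρ) = 0 := fun t ht =>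
      hzero t (mem_of_mem_erase ht) fun hx =>
        (ne_of_mem_erase ht) (eq_of_mem_collarB n M T hsep (mem_of_mem_erase ht) ht₀ hx hx₀)
    rw [← Finset.add_sum_erase T _ ht₀, Finset.sum_eq_zero hothers, add_zero,
      ← Finset.add_sum_erase T (fun t => ‖(GradOp (fine n M) (n : ℂ) *ᵥ liftB n M t.1 t.2 μt) (x, ρ)‖ ^ 2) ht₀]
    have : 0 ≤ ∑ t ∈ T.erase t₀, ‖(GradOp (fine n M) (n : ℂ) *ᵥ liftB n M t.1 t.2 μt) (x, ρ)‖ ^ 2 :=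
      sum_nonneg fun _ _ => by positivity
    linarith
  · simp only [not_exists, not_and] at h
    rw [Finset.sum_eq_zero (fun t ht => hzero t ht (h t ht)), norm_zero]
    simp only [ne_eq, OfNat.ofNat_ne_zero, not_false_eq_true, zero_pow]
    exact sum_nonneg fun _ _ => by positivity

/-- **THE BOXES' INTERNAL GRADIENT SUMS ADD UP INSIDE THE RESIDUAL** (their sites are pairwise disjoint). [folklore] -/
theorem sum_GK_family_le_residual (hT : ∀ t ∈ T, (∀ ν, 1 ≤ t.2 ν) ∧ ∀ ν, t.2 ν + 2 ≤ M ν)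
    (hsep : ∀ t ∈ T, ∀ t' ∈ T, t ≠ t' → ∀ k ∈ KOff t.2, ∀ k' ∈ KOff t'.2, cblkB M t.1 k ≠ cblkB M t'.1 k')
    (A : {b // starReg n M (fun y : Tor M => y ∉ boxesBlocks M T) b} → ℂ) (μt : Tor (fine n M) → ℂ) :
    ∑ t ∈ T, ∑ i ∈ KIn t.2, ∑ ρ, GK n M t.1 t.2 μt i ρ
      ≤ nsq (fun b => ext (starReg n M (fun y : Tor M => y ∉ boxesBlocks M T)) A b - (GradOp (fine n M) (n : ℂ) *ᵥ μt) b) := by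
  classical
  set R : Tor (fine n M) × Fin d → ℂ := fun b => ext (starReg n M (fun y : Tor M => y ∉ boxesBlocks M T)) A b - (GradOp (fine n M) (n : ℂ) *ᵥ μt) b with hR
  have hKS : ∀ t ∈ T, ∀ y ∈ boxBlocks M t.1 t.2, ¬ (y ∉ boxesBlocks M T) := fun t ht y hy h =>
    h (Finset.mem_biUnion.2 ⟨t, ht, hy⟩)
  -- per box
  have hbox : ∀ t ∈ T, ∑ i ∈ KIn t.2, ∑ ρ, GK n M t.1 t.2 μt i ρ ≤ ∑ ρ : Fin d, ∑ x ∈ boxSites n M t.1 t.2, ‖R (x, ρ)‖ ^ 2 :=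
    fun t ht => sum_GK_le_boxSum n M t.1 t.2 (fun y : Tor M => y ∉ boxesBlocks M T) (hKS t ht) (hT t ht).2 A μt
  -- the boxes' site sets are pairwise disjoint
  have hdisj : Set.PairwiseDisjoint (↑T : Set (Tor M × (Fin d → ℕ))) (fun t => boxSites n M t.1 t.2) := by
    intro t ht t' ht' hne
    rw [Function.onFun, Finset.disjoint_left]
    intro x hx hx'
    obtain ⟨ij, hij, rfl⟩ := Finset.mem_image.1 hx
    obtain ⟨ij', hij', heq⟩ := Finset.mem_image.1 hx'
    have hi : ij.1 ∈ KOff t.2 := KIn_subset_KOff t.2 (Finset.mem_product.1 hij).1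
    have hi' : ij'.1 ∈ KOff t'.2 := KIn_subset_KOff t'.2 (Finset.mem_product.1 hij').1
    apply hsep t ht t' ht' hne ij.1 hi ij'.1 hi'
    have h1 := congrArg (blockOf n M) heq
    rw [csiteB, csiteB, blockOf_bpt, blockOf_bpt] at h1
    exact h1.symm
  calc ∑ t ∈ T, ∑ i ∈ KIn t.2, ∑ ρ, GK n M t.1 t.2 μt i ρ
      ≤ ∑ t ∈ T, ∑ ρ : Fin d, ∑ x ∈ boxSites n M t.1 t.2, ‖R (x, ρ)‖ ^ 2 := sum_le_sum hbox
    _ = ∑ ρ : Fin d, ∑ t ∈ T, ∑ x ∈ boxSites n M t.1 t.2, ‖R (x, ρ)‖ ^ 2 := Finset.sum_comm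
    _ = ∑ ρ : Fin d, ∑ x ∈ T.biUnion (fun t => boxSites n M t.1 t.2), ‖R (x, ρ)‖ ^ 2 :=
        sum_congr rfl fun ρ _ => (Finset.sum_biUnion hdisj).symm
    _ ≤ ∑ ρ : Fin d, ∑ x : Tor (fine n M), ‖R (x, ρ)‖ ^ 2 :=
        sum_le_sum fun ρ _ => sum_le_sum_of_subset_of_nonneg (subset_univ _) fun _ _ _ => by positivity
    _ = nsq R := by unfold nsq; rw [Fintype.sum_prod_type_right]

/-! ## §3 The gauge–Poincaré inequality and W1 on the complement of a scattered family of boxes -/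

/-- **THE GAUGE–POINCARÉ INEQUALITY ON `T ∖ ⋃_t K_t`** (collars pairwise disjoint, `1 ≤ n`, `0 < a`, `0 < a′`), constants `K/γ_D`,
`K a/γ_D`, `K = 2 + 4(d+1)3^d`. [folklore] -/
theorem gaugePoincare_boxes (hT : ∀ t ∈ T, (∀ ν, 1 ≤ t.2 ν) ∧ ∀ ν, t.2 ν + 2 ≤ M ν)
    (hsep : ∀ t ∈ T, ∀ t' ∈ T, t ≠ t' → ∀ k ∈ KOff t.2, ∀ k' ∈ KOff t'.2, cblkB M t.1 k ≠ cblkB M t'.1 k')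
    (hn : 1 ≤ n) (ha : 0 < a) (ha' : 0 < a') (A : {b // starReg n M (fun y : Tor M => y ∉ boxesBlocks M T) b} → ℂ) :
    ∃ μ : {x // blockReg n M (fun y : Tor M => y ∉ boxesBlocks M T) x} → ℂ,
      nsq (A - gradR n M (fun y : Tor M => y ∉ boxesBlocks M T) *ᵥ μ) ≤ Kholed d / gamD d a * nsq (curlR n M (fun y : Tor M => y ∉ boxesBlocks M T) *ᵥ A)
        + Kholed d * a / gamD d a * ((n : ℝ) ^ d * nsq (avgR n M (fun y : Tor M => y ∉ boxesBlocks M T) *ᵥ A)) := by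
  classical
  obtain ⟨μt, hQ, hμt⟩ := exists_torus_gauge n M a a' (fun y : Tor M => y ∉ boxesBlocks M T) hn ha ha' A
  set R : Tor (fine n M) × Fin d → ℂ := fun b => ext (starReg n M (fun y : Tor M => y ∉ boxesBlocks M T)) A b - (GradOp (fine n M) (n : ℂ) *ᵥ μt) b with hR
  set lam := liftT n M T μt with hlam
  refine ⟨fun x => μt x.1 - lam x.1, ?_⟩
  have hext : ext (blockReg n M (fun y : Tor M => y ∉ boxesBlocks M T)) (fun x : {x // blockReg n M (fun y : Tor M => y ∉ boxesBlocks M T) x} => μt x.1 - lam x.1) = μt - lam := by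
    funext x
    by_cases hx : blockReg n M (fun y : Tor M => y ∉ boxesBlocks M T) x
    · exact ext_apply_of (blockReg n M (fun y : Tor M => y ∉ boxesBlocks M T)) _ ⟨x, hx⟩
    · rw [ext_apply_of_not _ _ hx, Pi.sub_apply]
      have hx' : blockOf n M x ∈ boxesBlocks M T := by
        have h' : ¬ (blockOf n M x ∉ boxesBlocks M T) := hx
        exact not_not.1 h'
      obtain ⟨t₀, ht₀, hx₀⟩ := Finset.mem_biUnion.1 hx'
      rw [hlam, liftT_of_mem_box n M T hT hsep μt ht₀ hx₀, sub_self]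
  have hres : ext (starReg n M (fun y : Tor M => y ∉ boxesBlocks M T)) (A - gradR n M (fun y : Tor M => y ∉ boxesBlocks M T) *ᵥ fun x => μt x.1 - lam x.1)
      = fun b => if starReg n M (fun y : Tor M => y ∉ boxesBlocks M T) b then R b + (GradOp (fine n M) (n : ℂ) *ᵥ lam) b else 0 := by
    funext b
    by_cases hb : starReg n M (fun y : Tor M => y ∉ boxesBlocks M T) b
    · rw [if_pos hb, ext_apply_of (starReg n M (fun y : Tor M => y ∉ boxesBlocks M T)) _ ⟨b, hb⟩, Pi.sub_apply, gradR, toBlock_mulVec', hext, hR]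
      simp only
      rw [Matrix.mulVec_sub, Pi.sub_apply, ext_apply_of (starReg n M (fun y : Tor M => y ∉ boxesBlocks M T)) A ⟨b, hb⟩]
      ring
    · rw [if_neg hb, ext_apply_of_not _ _ hb]
  have hgrad : nsq (GradOp (fine n M) (n : ℂ) *ᵥ lam) ≤ (2 * 3 ^ d + 2 * d * 3 ^ d) * nsq R := by
    have h1 := nsq_grad_liftT_le n M T hT hsep μt
    have h2 := sum_GK_family_le_residual n M T hT hsep A μt
    have h33 : (0 : ℝ) ≤ 2 * d * 3 ^ d := by positivity
    have h22 : (0 : ℝ) ≤ 2 * 3 ^ d := by positivity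
    have ht : ∀ t ∈ T, nsq (GradOp (fine n M) (n : ℂ) *ᵥ liftB n M t.1 t.2 μt)
        ≤ (2 * 3 ^ d + 2 * d * 3 ^ d) * ∑ i ∈ KIn t.2, ∑ ρ, GK n M t.1 t.2 μt i ρ := by
      intro t ht
      have h3 := sum_massK_le n M t.1 t.2 μt hQ
      calc nsq (GradOp (fine n M) (n : ℂ) *ᵥ liftB n M t.1 t.2 μt)
          ≤ 2 * 3 ^ d * ∑ i ∈ KIn t.2, ∑ ρ, GK n M t.1 t.2 μt i ρ + 2 * d * 3 ^ d * ∑ i ∈ KIn t.2, massK n M t.1 μt i :=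
            nsq_grad_liftB_le n M t.1 t.2 (hT t ht).1 (hT t ht).2 μt
        _ ≤ 2 * 3 ^ d * ∑ i ∈ KIn t.2, ∑ ρ, GK n M t.1 t.2 μt i ρ + 2 * d * 3 ^ d * ∑ i ∈ KIn t.2, ∑ ρ, GK n M t.1 t.2 μt i ρ :=
            add_le_add le_rfl (mul_le_mul_of_nonneg_left h3 h33)
        _ = _ := by ring
    calc nsq (GradOp (fine n M) (n : ℂ) *ᵥ lam) ≤ ∑ t ∈ T, nsq (GradOp (fine n M) (n : ℂ) *ᵥ liftB n M t.1 t.2 μt) := h1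
      _ ≤ ∑ t ∈ T, (2 * 3 ^ d + 2 * d * 3 ^ d) * ∑ i ∈ KIn t.2, ∑ ρ, GK n M t.1 t.2 μt i ρ := sum_le_sum ht
      _ = (2 * 3 ^ d + 2 * d * 3 ^ d) * ∑ t ∈ T, ∑ i ∈ KIn t.2, ∑ ρ, GK n M t.1 t.2 μt i ρ := by rw [mul_sum]
      _ ≤ (2 * 3 ^ d + 2 * d * 3 ^ d) * nsq R := mul_le_mul_of_nonneg_left h2 (by positivity)
  have hsum : nsq (A - gradR n M (fun y : Tor M => y ∉ boxesBlocks M T) *ᵥ fun x => μt x.1 - lam x.1) ≤ 2 * nsq R + 2 * nsq (GradOp (fine n M) (n : ℂ) *ᵥ lam) := by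
    rw [← nsq_ext (starReg n M (fun y : Tor M => y ∉ boxesBlocks M T)), hres]
    unfold nsq
    rw [mul_sum, mul_sum, ← sum_add_distrib]
    refine sum_le_sum fun b _ => ?_
    dsimp only
    split_ifs
    · have := norm_add_le (R b) ((GradOp (fine n M) (n : ℂ) *ᵥ lam) b)
      nlinarith [norm_nonneg (R b + (GradOp (fine n M) (n : ℂ) *ᵥ lam) b), norm_nonneg (R b),
        norm_nonneg ((GradOp (fine n M) (n : ℂ) *ᵥ lam) b), sq_nonneg (‖R b‖ - ‖(GradOp (fine n M) (n : ℂ) *ᵥ lam) b‖)]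
    · rw [norm_zero]
      nlinarith [norm_nonneg (R b), norm_nonneg ((GradOp (fine n M) (n : ℂ) *ᵥ lam) b)]
  have hγ := gamD_pos (d := d) a
  have hRle : nsq R ≤ (nsq (curlR n M (fun y : Tor M => y ∉ boxesBlocks M T) *ᵥ A) + a * (n : ℝ) ^ d * nsq (avgR n M (fun y : Tor M => y ∉ boxesBlocks M T) *ᵥ A)) / gamD d a := by
    rw [le_div_iff₀ hγ, mul_comm]; exact hμt
  have hK : nsq (A - gradR n M (fun y : Tor M => y ∉ boxesBlocks M T) *ᵥ fun x => μt x.1 - lam x.1) ≤ Kholed d * nsq R := by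
    calc nsq (A - gradR n M (fun y : Tor M => y ∉ boxesBlocks M T) *ᵥ fun x => μt x.1 - lam x.1)
        ≤ 2 * nsq R + 2 * ((2 * 3 ^ d + 2 * d * 3 ^ d) * nsq R) := by linarith [hsum, hgrad]
      _ = Kholed d * nsq R := by rw [Kholed]; ring
  have hKpos : 0 ≤ Kholed d := by unfold Kholed; positivity
  calc nsq (A - gradR n M (fun y : Tor M => y ∉ boxesBlocks M T) *ᵥ fun x => μt x.1 - lam x.1) ≤ Kholed d * nsq R := hK
    _ ≤ Kholed d * ((nsq (curlR n M (fun y : Tor M => y ∉ boxesBlocks M T) *ᵥ A) + a * (n : ℝ) ^ d * nsq (avgR n M (fun y : Tor M => y ∉ boxesBlocks M T) *ᵥ A)) / gamD d a) :=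
        mul_le_mul_of_nonneg_left hRle hKpos
    _ = _ := by simp only [div_eq_mul_inv]; ring

/-- **W1 IN ORBIT FORM ON `T ∖ ⋃_t K_t`, EVERY LEVEL `n ≥ 1`**. [folklore] -/
theorem orthSlice_boxes (hT : ∀ t ∈ T, (∀ ν, 1 ≤ t.2 ν) ∧ ∀ ν, t.2 ν + 2 ≤ M ν)
    (hsep : ∀ t ∈ T, ∀ t' ∈ T, t ≠ t' → ∀ k ∈ KOff t.2, ∀ k' ∈ KOff t'.2, cblkB M t.1 k ≠ cblkB M t'.1 k') (ha : 0 < a) (ha' : 0 < a') :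
    OrthSliceCoercive (curlR n M (fun y : Tor M => y ∉ boxesBlocks M T)) (gradR n M (fun y : Tor M => y ∉ boxesBlocks M T)) (QOm n M (fun y : Tor M => y ∉ boxesBlocks M T)) (avgR n M (fun y : Tor M => y ∉ boxesBlocks M T)) (a * (n : ℝ) ^ d)
      (orbitConst d a (Kholed d / gamD d a) (Kholed d * a / gamD d a)) := by
  by_cases hn : 2 ≤ n
  · exact orthSlice_of_gaugePoincare n M a (fun y : Tor M => y ∉ boxesBlocks M T) hn ha (KC₂_nonneg a ha)
      (gaugePoincare_boxes n M T a a' hT hsep (by omega) ha ha')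
  · obtain rfl : n = 1 := by have := NeZero.ne n; omega
    exact orthSlice_one M (fun y : Tor M => y ∉ boxesBlocks M T) a (orbitConst_le ha (KC₂_nonneg a ha))

/-- **THE DISPLAYED W1 INEQUALITY ON THE COMPLEMENT OF ANY SCATTERED FAMILY OF BOXES OF BLOCKS — ONE LEVEL-UNIFORM CONSTANT**
`holedConst d a a′`, free of `n`, `M`, the family: `S = (· ∉ boxesBlocks M T)`, boxes `K_t = Π_ν [lo^t_ν, lo^t_ν + len^t_ν)` with
`1 ≤ len^t_ν`, `len^t_ν + 2 ≤ M_ν`, collars pairwise disjoint; every level `n ≥ 1`, `0 < a`, `0 < a′`. [folklore] -/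
theorem sliceCoercive_boxes (hT : ∀ t ∈ T, (∀ ν, 1 ≤ t.2 ν) ∧ ∀ ν, t.2 ν + 2 ≤ M ν)
    (hsep : ∀ t ∈ T, ∀ t' ∈ T, t ≠ t' → ∀ k ∈ KOff t.2, ∀ k' ∈ KOff t'.2, cblkB M t.1 k ≠ cblkB M t'.1 k') (ha : 0 < a) (ha' : 0 < a') :
    SliceCoercive (curlR n M (fun y : Tor M => y ∉ boxesBlocks M T)) (gradR n M (fun y : Tor M => y ∉ boxesBlocks M T)) (GOm n M a' (fun y : Tor M => y ∉ boxesBlocks M T)) (QOm n M (fun y : Tor M => y ∉ boxesBlocks M T)) (avgR n M (fun y : Tor M => y ∉ boxesBlocks M T)) (a * (n : ℝ) ^ d) (holedConst d a a') :=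
  sliceCoercive_region_of_orthSlice n M a a' (fun y : Tor M => y ∉ boxesBlocks M T) ha' (orbitConst_pos d ha (KC₂_nonneg a ha)).le
    (orthSlice_boxes n M T a a' hT hsep ha ha')

/-- coercivity of `Δ_a(Ω₀)` on `T ∖ ⋃_t K_t`, uniformly in the level. [folklore] -/
theorem coercive_regionDeltaA_boxes (hT : ∀ t ∈ T, (∀ ν, 1 ≤ t.2 ν) ∧ ∀ ν, t.2 ν + 2 ≤ M ν)
    (hsep : ∀ t ∈ T, ∀ t' ∈ T, t ≠ t' → ∀ k ∈ KOff t.2, ∀ k' ∈ KOff t'.2, cblkB M t.1 k ≠ cblkB M t'.1 k') (ha : 0 < a) (ha' : 0 < a') :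
    Coercive (regionDeltaA n M a a' (fun y : Tor M => y ∉ boxesBlocks M T))
      (min (orbitConst d a (Kholed d / gamD d a) (Kholed d * a / gamD d a) / (1 + 4 * d / sigma0 d a') / 2)
        (1 / (2 * (gammaPs d a')⁻¹))) :=
  coercive_regionDeltaA_of_orthSlice n M a a' (fun y : Tor M => y ∉ boxesBlocks M T) ha' (orbitConst_pos d ha (KC₂_nonneg a ha)) (orthSlice_boxes n M T a a' hT hsep ha ha')

/-- «`G(Ω₀)` exists with a level-uniform bound» on `T ∖ ⋃_t K_t`. [folklore] -/
theorem opNorm_inv_regionDeltaA_boxes_le (hT : ∀ t ∈ T, (∀ ν, 1 ≤ t.2 ν) ∧ ∀ ν, t.2 ν + 2 ≤ M ν)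
    (hsep : ∀ t ∈ T, ∀ t' ∈ T, t ≠ t' → ∀ k ∈ KOff t.2, ∀ k' ∈ KOff t'.2, cblkB M t.1 k ≠ cblkB M t'.1 k') (ha : 0 < a) (ha' : 0 < a') :
    ‖(regionDeltaA n M a a' (fun y : Tor M => y ∉ boxesBlocks M T))⁻¹‖
      ≤ (min (orbitConst d a (Kholed d / gamD d a) (Kholed d * a / gamD d a) / (1 + 4 * d / sigma0 d a') / 2)
          (1 / (2 * (gammaPs d a')⁻¹)))⁻¹ :=
  opNorm_inv_regionDeltaA_le_of_orthSlice n M a a' (fun y : Tor M => y ∉ boxesBlocks M T) ha' (orbitConst_pos d ha (KC₂_nonneg a ha))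
    (orthSlice_boxes n M T a a' hT hsep ha ha')

/-- **THE STAR-TOWER W1 SOCKET DISCHARGED ON `T ∖ ⋃_t K_t`**: `∀ k, SliceCoercive (… lev L k …) (holedConst d a a′)`. [folklore] -/
theorem sliceCoercive_lev_boxes (L : ℕ) [NeZero L] (hT : ∀ t ∈ T, (∀ ν, 1 ≤ t.2 ν) ∧ ∀ ν, t.2 ν + 2 ≤ M ν)
    (hsep : ∀ t ∈ T, ∀ t' ∈ T, t ≠ t' → ∀ k ∈ KOff t.2, ∀ k' ∈ KOff t'.2, cblkB M t.1 k ≠ cblkB M t'.1 k') (ha : 0 < a) (ha' : 0 < a')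
    (k : ℕ) :
    SliceCoercive (curlR (lev L k) M (fun y : Tor M => y ∉ boxesBlocks M T)) (gradR (lev L k) M (fun y : Tor M => y ∉ boxesBlocks M T)) (GOm (lev L k) M a' (fun y : Tor M => y ∉ boxesBlocks M T)) (QOm (lev L k) M (fun y : Tor M => y ∉ boxesBlocks M T)) (avgR (lev L k) M (fun y : Tor M => y ∉ boxesBlocks M T))
      (a * ((lev L k : ℕ) : ℝ) ^ d) (holedConst d a a') :=
  sliceCoercive_boxes (lev L k) M T a a' hT hsep ha ha'

end Summit.QuantumFields.BalabanUV.T4Continuum.RegionGaugeScatteredBoxes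

end
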